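import Mathlib
import Literature.NumberTheory.EllipticCurves.ThreeIsogeny
import Literature.NumberTheory.EllipticCurves.MordellCurvePhiDescentHom
import Summits.BirchSwinnertonDyer.BirchSwinnertonDyer.Theorems.Rank2ObservatoryThreeIsoDescentEhat
import Summits.BirchSwinnertonDyer.BirchSwinnertonDyer.Theorems.Rank2ObservatoryThreeIsoKField

/-!
# BirchSwinnertonDyer — rank ≥ 2 observatory, KERNEL-3ISO (B3b-1): integral normal form of the Ê-side value

HONEST FRAMING: per-curve certified theorems and census instruments; no claim on BSD in rank ≥ 2.

For the `3`-isogeny descent on `E_{m,s} : y² = x³ + (mx + s)²` (`m, s ∈ ℤ`) the `Ê`-side descent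
value of a rational point `Q = (X, Y) ∈ Ê(ℚ)` is the cube class of
`δ = Y - θ (m x̂ + b̂)`, `x̂ = X + 4m²/3`, `b̂ = (27s - 4m³)/9`, `θ² = -3`
(`Rank2ObservatoryThreeIsoKField.exists_descentHom_Ehat_cyclotomic`). This file puts `δ` into the
INTEGRAL NORMAL FORM on which the support law (Cohen, *Number Theory I*, Prop. 8.4.8 (3);
Cohen–Pazuki, Prop. 2.2) is an exercise in the arithmetic of `ℤ[ζ₃]`:

* `exists_lowest_terms` — a rational point on an integral model `y² = x³ + a₂x² + a₄x + a₆` has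
  `x = n/e²`, `y = t/e³` with `e > 0` and `gcd(n, e) = 1` (elementary: no valuations);
* `exists_integral_descent_value` — `[δ] = [t - θ C]` in `K×/K×³` with `C = 3mne + (81s - 12m³)e³`,
  `t² + 3C² = n³`, `gcd(n, e) = 1`, `e > 0` (rescale by `27 = 3³`, pass to the integral model
  `Y₂² = X₂³ - 3(3mX₂ + s₁)²`, `s₁ = 81s - 12m³`, clear denominators by the cube `e³`);
* `exists_ringOfIntegers_descent_value` — the same packaged in `𝓞 K`, `K = ℚ(ζ₃)`: elements
  `θ₀ = 2ζ + 1`, `δ₀ = t - θ₀C`, `ε₀ = t + θ₀C` of `𝓞 K` with `δ₀ ε₀ = n³`, `δ₀ ≠ 0`, and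
  `κ'(Q) = [δ₀]`; together with `Rank2ObservatoryThreeIsoKField.not_dvd_both_of_good` (every common
  prime of `δ₀, ε₀` divides `2θ₀s₁`) and `Rank2ObservatoryThreeIsoUFD` (cubes up to units and bad
  primes in a PID) this is the input of the per-row `Ê`-side image bound.

No definitions. References: H. Cohen, *Number Theory I* (GTM 239, 2007), §8.4, Prop. 8.4.8;
H. Cohen, F. Pazuki, *Elementary 3-descent with a 3-isogeny*, arXiv:0903.4963, §2.
-/

set_option linter.dupNamespace false

noncomputable section

open WeierstrassCurve NumberField

namespace Summit.BirchSwinnertonDyer.BirchSwinnertonDyer.Rank2Observatory.ThreeIso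

open Literature.NumberTheory.EllipticCurves Literature.NumberTheory.EllipticCurves.MordellDescent

section LowestTerms

/-- **Lowest terms.** A rational point `(X, Y)` on an integral model `y² = x³ + a₂x² + a₄x + a₆`
has `X = n/e²`, `Y = t/e³` with `e > 0` and `gcd(n, e) = 1`. Elementary proof: with `X = n/d`,
`Y = n'/d'` in lowest terms, `n'² d³ = N d'²` with `gcd(N, d) = gcd(n', d') = 1` forces `d³ = d'²`,
so `d = (d'/d)²`. [cite: Cohen2007NumberTheoryI, §8.1 (integral points, folklore)] -/
theorem exists_lowest_terms {a₂ a₄ a₆ : ℤ} {X Y : ℚ}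
    (hE : Y ^ 2 = X ^ 3 + a₂ * X ^ 2 + a₄ * X + a₆) :
    ∃ n t e : ℤ, 0 < e ∧ IsCoprime n e ∧ X = n / (e : ℚ) ^ 2 ∧ Y = t / (e : ℚ) ^ 3 := by
  -- numerators and denominators
  obtain ⟨n, d, hd0, hX, hcop⟩ : ∃ n d : ℤ, 0 < d ∧ X = n / d ∧ IsCoprime n d := by
    refine ⟨X.num, X.den, by exact_mod_cast X.den_pos, (Rat.num_div_den X).symm, ?_⟩
    rw [Int.isCoprime_iff_gcd_eq_one]
    exact X.reduced
  obtain ⟨n', d', hd'0, hY, hcop'⟩ : ∃ n' d' : ℤ, 0 < d' ∧ Y = n' / d' ∧ IsCoprime n' d' := by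
    refine ⟨Y.num, Y.den, by exact_mod_cast Y.den_pos, (Rat.num_div_den Y).symm, ?_⟩
    rw [Int.isCoprime_iff_gcd_eq_one]
    exact Y.reduced
  -- the cross-multiplied equation `n'² d³ = N d'²`
  have key : n' ^ 2 * d ^ 3 = (n ^ 3 + a₂ * n ^ 2 * d + a₄ * n * d ^ 2 + a₆ * d ^ 3) * d' ^ 2 := by
    have hdq : (d : ℚ) ≠ 0 := by exact_mod_cast hd0.ne'
    have hd'q : (d' : ℚ) ≠ 0 := by exact_mod_cast hd'0.ne'
    have h := hE
    rw [hX, hY, div_pow, div_pow, div_eq_iff (pow_ne_zero 2 hd'q)] at h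
    have h' : (n' : ℚ) ^ 2 * (d : ℚ) ^ 3 =
        ((n : ℚ) ^ 3 + a₂ * (n : ℚ) ^ 2 * d + a₄ * n * (d : ℚ) ^ 2 + a₆ * (d : ℚ) ^ 3) * (d' : ℚ) ^ 2 := by
      rw [h]
      field_simp
    exact_mod_cast h'
  -- `gcd(N, d) = 1`, hence `d³ ∣ d'²`; `gcd(n', d') = 1`, hence `d'² ∣ d³`
  have hNd : IsCoprime (n ^ 3 + a₂ * n ^ 2 * d + a₄ * n * d ^ 2 + a₆ * d ^ 3) d := by
    have : n ^ 3 + a₂ * n ^ 2 * d + a₄ * n * d ^ 2 + a₆ * d ^ 3 =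
        n ^ 3 + d * (a₂ * n ^ 2 + a₄ * n * d + a₆ * d ^ 2) := by ring
    rw [this]
    exact (hcop.pow_left (m := 3)).add_mul_left_left _
  have h1 : d ^ 3 ∣ d' ^ 2 :=
    (hNd.symm.pow_left (m := 3)).dvd_of_dvd_mul_left ⟨n' ^ 2, by rw [← key]; ring⟩
  have h2 : d' ^ 2 ∣ d ^ 3 :=
    ((hcop'.symm).pow (m := 2) (n := 2)).dvd_of_dvd_mul_left
      ⟨n ^ 3 + a₂ * n ^ 2 * d + a₄ * n * d ^ 2 + a₆ * d ^ 3, by rw [key]; ring⟩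
  have h3 : d ^ 3 = d' ^ 2 := Int.dvd_antisymm (by positivity) (by positivity) h1 h2
  -- `e = d'/d`
  have h4 : d ∣ d' := (Int.pow_dvd_pow_iff two_ne_zero).mp ⟨d, by rw [← h3]; ring⟩
  obtain ⟨e, he⟩ := h4
  have he2 : d = e ^ 2 := by
    have : d ^ 2 * d = d ^ 2 * e ^ 2 := by
      calc d ^ 2 * d = d ^ 3 := by ring
        _ = d' ^ 2 := h3
        _ = d ^ 2 * e ^ 2 := by rw [he]; ring
    exact mul_left_cancel₀ (pow_ne_zero 2 hd0.ne') this
  have he3 : d' = e ^ 3 := by rw [he, he2]; ring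
  have he0 : 0 < e := by
    rw [he] at hd'0
    exact pos_of_mul_pos_right hd'0 hd0.le
  refine ⟨n, n', e, he0, ?_, ?_, ?_⟩
  · rw [he2] at hcop
    exact (IsCoprime.pow_right_iff two_pos).mp hcop
  · rw [hX, he2]; push_cast; rfl
  · rw [hY, he3]; push_cast; rfl

end LowestTerms

section IntegralValue

variable {K : Type*} [Field K] [CharZero K]

/-- **Integral normal form of the `Ê`-side descent value.** For `m, s ∈ ℤ`, a Vélu pair
`(W, W')` for `(m, s)` over `ℚ`, any `θ` in a field `K ⊇ ℚ` (intended: `θ² = -3`), and a point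
`(X, Y) ∈ W'(ℚ)`:
there are integers `n, t, e` with `e > 0`, `gcd(n, e) = 1`,
`t² + 3C² = n³` for `C = 3mne + (81s - 12m³)e³`, and
`[Y - θ(m x̂ + b̂)] = [t - θC]` in `K×/K×³`. (Rescale by `27`, lowest terms on the integral model
`Y₂² = X₂³ - 27m²X₂² - 18m s₁ X₂ - 3s₁²`, `(X₂, Y₂) = (9X + 12m², 27Y)`, `s₁ = 81s - 12m³`, then
clear the cube `e³`.) [cite: CohenPazuki2009, §2] [cite: Cohen2007NumberTheoryI, Prop. 8.4.8 (3)] -/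
theorem exists_integral_descent_value (θ : K) {m s : ℤ}
    {W W' : WeierstrassCurve ℚ} (h : IsVeluThreePair (m : ℚ) (s : ℚ) W W')
    {X Y : ℚ} (hQ : W'.toAffine.Nonsingular X Y) :
    ∃ n t e : ℤ, 0 < e ∧ IsCoprime n e ∧
      t ^ 2 + 3 * (3 * m * n * e + (81 * s - 12 * m ^ 3) * e ^ 3) ^ 2 = n ^ 3 ∧
      cubeClass ((Y : K) - θ * (((m : ℚ) : K) * ((X : K) + 4 * ((m : ℚ) : K) ^ 2 / 3)
          + (27 * ((s : ℚ) : K) - 4 * ((m : ℚ) : K) ^ 3) / 9)) =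
        cubeClass ((t : K) - θ * ((3 * m * n * e + (81 * s - 12 * m ^ 3) * e ^ 3 : ℤ) : K)) := by
  -- the integral model through `(X₂, Y₂) = (9X + 12m², 27Y)`
  have hE : Y ^ 2 = X ^ 3 + (m : ℚ) ^ 2 * X ^ 2 - 18 * m * s * X - (27 * (s : ℚ) ^ 2 + 16 * m ^ 3 * s) :=
    (h.equation'_iff X Y).mp hQ.left
  have hE₂ : (27 * Y) ^ 2 = (9 * X + 12 * (m : ℚ) ^ 2) ^ 3 + ((-27 * m ^ 2 : ℤ) : ℚ) * (9 * X + 12 * (m : ℚ) ^ 2) ^ 2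
      + ((-18 * m * (81 * s - 12 * m ^ 3) : ℤ) : ℚ) * (9 * X + 12 * (m : ℚ) ^ 2)
      + ((-3 * (81 * s - 12 * m ^ 3) ^ 2 : ℤ) : ℚ) := by
    push_cast
    linear_combination 729 * hE
  obtain ⟨n, t, e, he0, hcop, hX₂, hY₂⟩ := exists_lowest_terms hE₂
  have heq : (e : ℚ) ≠ 0 := by exact_mod_cast he0.ne'
  -- the norm identity `t² + 3C² = n³`
  have hN : t ^ 2 + 3 * (3 * m * n * e + (81 * s - 12 * m ^ 3) * e ^ 3) ^ 2 = n ^ 3 := by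
    have h1 : ((t : ℚ) / (e : ℚ) ^ 3) ^ 2 = ((n : ℚ) / (e : ℚ) ^ 2) ^ 3
        + ((-27 * m ^ 2 : ℤ) : ℚ) * ((n : ℚ) / (e : ℚ) ^ 2) ^ 2
        + ((-18 * m * (81 * s - 12 * m ^ 3) : ℤ) : ℚ) * ((n : ℚ) / (e : ℚ) ^ 2)
        + ((-3 * (81 * s - 12 * m ^ 3) ^ 2 : ℤ) : ℚ) := by
      rw [← hX₂, ← hY₂]; exact hE₂
    have h2 : ((t ^ 2 + 3 * (3 * m * n * e + (81 * s - 12 * m ^ 3) * e ^ 3) ^ 2 : ℤ) : ℚ) =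
        ((n ^ 3 : ℤ) : ℚ) := by
      field_simp at h1
      push_cast at h1 ⊢
      linear_combination h1
    exact_mod_cast h2
  refine ⟨n, t, e, he0, hcop, hN, ?_⟩
  -- the class identity: `27 δ = Y₂ - θ(3m X₂ + s₁) = (t - θC) / e³`
  have hK : (e : K) ≠ 0 := by exact_mod_cast he0.ne'
  have hresc := descent_Ehat_rescale (θ := θ) (m : ℚ) (s : ℚ) X Y
  have hval : ((27 * Y : ℚ) : K) - θ * (((3 * (m : ℚ) : ℚ) : K) * ((9 * X + 12 * (m : ℚ) ^ 2 : ℚ) : K)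
        + ((81 * (s : ℚ) - 12 * (m : ℚ) ^ 3 : ℚ) : K)) =
      (((t : K) - θ * ((3 * m * n * e + (81 * s - 12 * m ^ 3) * e ^ 3 : ℤ) : K))) * ((e : K)⁻¹) ^ 3 := by
    rw [hY₂, hX₂]
    push_cast
    field_simp
  rw [← cubeClass_twentySeven_mul, hresc, hval]
  by_cases hδ : (t : K) - θ * ((3 * m * n * e + (81 * s - 12 * m ^ 3) * e ^ 3 : ℤ) : K) = 0
  · rw [hδ, zero_mul]
  · exact cubeClass_mul_pow_three hδ (inv_ne_zero hK)

end IntegralValue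

section RingOfIntegers

variable {K : Type*} [Field K] [NumberField K]

/-- **The `Ê`-side value in `𝓞 K`, `K = ℚ(ζ₃)`.** For a point `Q = (X, Y) ∈ Ê(ℚ)` of the Vélu pair of
`E_{m,s}` (`m, s ∈ ℤ`) there are integers `n, t, e` (`e > 0`, `gcd(n, e) = 1`,
`t² + 3C² = n³`, `C = 3mne + s₁e³`, `s₁ = 81s - 12m³`) and algebraic integers
`θ₀ = 2ζ + 1`, `δ₀ = t - θ₀C`, `ε₀ = t + θ₀C` of `K` with `θ₀² = -3`, `δ₀ ε₀ = n³`, `δ₀ ≠ 0`,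
`ε₀ ≠ 0`, such that the descent value `κ'(Q)` of
`Rank2ObservatoryThreeIsoKField.exists_descentHom_Ehat_cyclotomic` is the class `[δ₀]`.
[cite: Cohen2007NumberTheoryI, Prop. 8.4.8 (3)] [cite: CohenPazuki2009, Prop. 2.2] -/
theorem exists_ringOfIntegers_descent_value {ζ : K} (hζ : IsPrimitiveRoot ζ 3) {m s : ℤ}
    {W W' : WeierstrassCurve ℚ} (h : IsVeluThreePair (m : ℚ) (s : ℚ) W W')
    {X Y : ℚ} (hQ : W'.toAffine.Nonsingular X Y) :
    ∃ (n t e : ℤ) (θ₀ δ₀ ε₀ : 𝓞 K), 0 < e ∧ IsCoprime n e ∧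
      t ^ 2 + 3 * (3 * m * n * e + (81 * s - 12 * m ^ 3) * e ^ 3) ^ 2 = n ^ 3 ∧
      (θ₀ : K) = 2 * ζ + 1 ∧ θ₀ ^ 2 = -3 ∧
      δ₀ = t - θ₀ * ((3 * m * n * e + (81 * s - 12 * m ^ 3) * e ^ 3 : ℤ) : 𝓞 K) ∧
      ε₀ = t + θ₀ * ((3 * m * n * e + (81 * s - 12 * m ^ 3) * e ^ 3 : ℤ) : 𝓞 K) ∧
      δ₀ * ε₀ = (n : 𝓞 K) ^ 3 ∧ δ₀ ≠ 0 ∧ ε₀ ≠ 0 ∧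
      cubeClass ((Y : K) - (2 * ζ + 1) * (((m : ℚ) : K) * ((X : K) + 4 * ((m : ℚ) : K) ^ 2 / 3)
          + (27 * ((s : ℚ) : K) - 4 * ((m : ℚ) : K) ^ 3) / 9)) = cubeClass (δ₀ : K) := by
  have hθ : ((2 : K) * ζ + 1) ^ 2 = -3 := theta_sq_eq hζ
  obtain ⟨n, t, e, he0, hcop, hN, hclass⟩ := exists_integral_descent_value (2 * ζ + 1) h hQ
  -- `θ₀ = 2ζ + 1` is an algebraic integer
  have hζint : IsIntegral ℤ ζ := hζ.isIntegral (by norm_num)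
  have hθint : _root_.IsIntegral ℤ ((2 : K) * ζ + 1) := by
    have h2 : _root_.IsIntegral ℤ (2 : K) := by
      simpa using isIntegral_algebraMap (R := ℤ) (A := K) (x := 2)
    exact (h2.mul hζint).add isIntegral_one
  set θ₀ : 𝓞 K := ⟨2 * ζ + 1, hθint⟩ with hθ₀def
  have hθ₀K : ((θ₀ : 𝓞 K) : K) = 2 * ζ + 1 := rfl
  have hθ₀ : θ₀ ^ 2 = -3 := by
    apply RingOfIntegers.ext
    simp only [map_pow, map_neg, map_ofNat, hθ₀def, RingOfIntegers.map_mk]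
    exact hθ
  set C : ℤ := 3 * m * n * e + (81 * s - 12 * m ^ 3) * e ^ 3 with hC
  -- coercions `𝓞 K → K` of the two values
  have hcoe : ∀ σ : ℤ, (((t : 𝓞 K) + (σ : 𝓞 K) * (θ₀ * (C : 𝓞 K)) : 𝓞 K) : K) =
      (t : K) + (σ : K) * ((2 * ζ + 1) * (C : K)) := by
    intro σ
    simp only [map_add, map_mul, map_intCast, hθ₀def, RingOfIntegers.map_mk]
  -- non-vanishing: `t = C = 0` would force `n = 0`, then `s₁ e³ = 0`, i.e. `27 s = 4 m³`
  have hs₁ : (81 * s - 12 * m ^ 3 : ℤ) ≠ 0 := by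
    intro h0
    apply h.disc_ne
    have h0' : (81 * (s : ℚ) - 12 * (m : ℚ) ^ 3) = 0 := by exact_mod_cast h0
    linear_combination (-1 / 3 : ℚ) * h0'
  have htC : ¬ (t = 0 ∧ C = 0) := by
    rintro ⟨ht, hC0⟩
    have hn : n = 0 := by
      have h3 : n ^ 3 = 0 := by rw [← hN, ht, hC0]; ring
      exact pow_eq_zero_iff (by norm_num) |>.mp h3
    have h4 : (81 * s - 12 * m ^ 3) * e ^ 3 = 0 := by
      have h5 := hC0
      rw [hC, hn] at h5
      linear_combination h5
    rcases mul_eq_zero.mp h4 with h6 | h6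
    · exact hs₁ h6
    · exact he0.ne' (pow_eq_zero_iff (by norm_num) |>.mp h6)
  have hne : ∀ σ : ℤ, σ ^ 2 = 1 → (t : 𝓞 K) + (σ : 𝓞 K) * (θ₀ * (C : 𝓞 K)) ≠ 0 := by
    intro σ hσ hzero
    apply htC
    have h1 := congrArg (fun z : 𝓞 K => (z : K)) hzero
    simp only [hcoe σ, map_zero] at h1
    have hK0 : ((t : ℚ) : K) + (((σ * C : ℤ) : ℚ) : K) * (2 * ζ + 1) = 0 := by
      push_cast
      linear_combination h1
    obtain ⟨ht0, hσC⟩ := rat_coords_eq_zero hθ hK0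
    refine ⟨by exact_mod_cast ht0, ?_⟩
    have hσC' : σ * C = 0 := by exact_mod_cast hσC
    rcases mul_eq_zero.mp hσC' with hσ0 | hC0
    · rw [hσ0] at hσ; norm_num at hσ
    · exact hC0
  refine ⟨n, t, e, θ₀, t - θ₀ * (C : 𝓞 K), t + θ₀ * (C : 𝓞 K), he0, hcop, hN, hθ₀K, hθ₀, rfl, rfl,
    ?_, ?_, ?_, ?_⟩
  · -- `δ₀ ε₀ = t² + 3C² = n³`
    rw [sub_mul_add_theta hθ₀]
    exact_mod_cast hN
  · have h1 := hne (-1) (by norm_num)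
    intro h0; apply h1
    rw [← h0]; push_cast; ring
  · have h1 := hne 1 (by norm_num)
    intro h0; apply h1
    rw [← h0]; push_cast; ring
  · rw [hclass]
    have h2 : (((t : 𝓞 K) - θ₀ * (C : 𝓞 K) : 𝓞 K) : K) = (t : K) - (2 * ζ + 1) * (C : K) := by
      rw [show (t : 𝓞 K) - θ₀ * (C : 𝓞 K) = (t : 𝓞 K) + ((-1 : ℤ) : 𝓞 K) * (θ₀ * (C : 𝓞 K)) by
        push_cast; ring, hcoe (-1)]
      push_cast
      ring
    rw [h2]

end RingOfIntegers

end Summit.BirchSwinnertonDyer.BirchSwinnertonDyer.Rank2Observatory.ThreeIso
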